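import Mathlib
import HarnessLib
import Summits.CriticalPhenomena.CardyFormulaZ2.Theorems.CardyMagicRigidityMagicFormulaTCoefficientExchange
import Summits.CriticalPhenomena.CardyFormulaZ2.Theorems.CardyMagicRigidityMagicFormulaTCoefficientFormulas
import Summits.CriticalPhenomena.CardyFormulaZ2.Theorems.CardyMagicRigidityMagicFormulaTSecondOrderReduction
import Literature.Probability.Percolation.SiteNestingWeightBound

/-!
# Line `Sketch` (v10) for crux `MagicFormulaT`, wave-4 sub-goals CF-4 and FO:
# the fourth Taylor coefficient at zero coupling and the order-4 reduction

Crux `Summit.CriticalPhenomena.CardyFormulaZ2.Theses.CardyMagicRigidity.MagicFormulaT`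
(stmt-CriticalPhenomena-4836), line `Sketch`, skeleton v9 → v10, wave-4 sub-goals
`cf_iteratedDeriv_four_finprod` (CF-4) and `fo_fourthOrder_of_fourPoint` (FO).

Notation.  For an admissible density `f` (`|f| ≤ C`, `f = 0` off `B̄(0, R)`, `∫ f = 0`) and a loop `u` put
`θ_u = u.nestingPhase f`; for a loop family `L` put `A_m = Σᶠ_{u ∈ L} θ_u^m` and
`P(t) = ∏ᶠ_{u ∈ L} 2cos(t θ_u + π/3)`.  With `L` the loops of `siteLoopConfig δ ω`,
`Φ_δ(t) = E_{1/2}[P(t)]`, and `G_f(t) = exp(q(f) t²)`, `q(f) = (3/4π²) ∬ log‖x − y‖ f(x) f(y)`.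

**CF-4.**  If finitely many members of `L` meet `B̄(0, R)`, then
`P''''(0) = 9A₁⁴ − 72A₁²A₂ + 48A₂² + 96A₁A₃ − 80A₄`.
Proof.  `P` is a finite product over the loops meeting the ball (`stubEntire_finprod_eq_prod`) and the `A_m`
are finite sums (`cff_finsum_pow_eq_sum`).  For a finite product `P_S(t) = ∏_{i∈S} 2cos(t c_i + π/3)` the
value `P_S''''(0)` is computed by induction on `S`: the Leibniz rule at order `4` for
`P_{insert a S} = w_a · P_S` (`iteratedDeriv_mul`, binomials `1, 4, 6, 4, 1`), the single-factor values
`w_a^{(k)}(0) = 1, −√3c, −c², √3c³, c⁴` (`k = 0, …, 4`; order `4` from `cos'''' = cos`, `2cos(π/3) = 1`), the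
lower-order product values `P_S^{(j)}(0)`, `j ≤ 3` (`cff_iteratedDeriv_prod`), and a polynomial identity in
the power sums of `insert a S` modulo `(√3)² = 3`.

**FO.**  If `E_{1/2}[9A₁⁴ − 72A₁²A₂ + 48A₂² + 96A₁A₃ − 80A₄] → 12 q(f)²` as `δ ↓ 0`, then every limit `a`
of `Φ_δ''''(0)` along `δ ↓ 0` equals `G_f''''(0)`.
Proof.  (1) For `δ > 0`, `Φ_δ''''(0) = E[∂_t⁴ P |_{t=0}]` (`cf_iteratedDeriv_eq_integral`) `= E[9A₁⁴ − …]`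
(CF-4 pathwise; finitely many loops meet the ball at fixed mesh, `ncard_loops_siteLoopConfig_meeting_le`),
a real number (`integral_complex_ofReal`).  (2) Hence `Φ_δ''''(0) → 12 q(f)²` in `ℂ` along `𝓝[>] 0`, and
`a = 12 q(f)²` by uniqueness of limits.  (3) `G_f''''(0) = 12 q(f)²` (the Wick value
`3 · (G_f''(0))² = 3 · (2q)²`, i.e. the coefficient `4! · q²/2!` of the exponential series): differentiating
`exp(c t²)` thrice as a function gives `(2ct)e^{ct²}`, `(2c + 4c²t²)e^{ct²}`, `(12c²t + 8c³t³)e^{ct²}`, whose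
derivative at `t = 0` is `12c²`.
No named fact is used; no definition is introduced.
-/

noncomputable section

namespace Summit.CriticalPhenomena.CardyFormulaZ2.Cruxes.MagicFormulaT.LineSketch

open MeasureTheory Filter Set
open scoped Real Topology BigOperators ENNReal
open Literature.Probability.RandomPlanarGeometry Literature.Probability.Percolation
  Literature.Probability.LatticeModels

/-! ## The single factor at order `4` and the finite-product induction -/

/-- The fourth `t`-derivative of `2cos(t c + π/3)` at `t = 0` is `c⁴` (`cos'''' = cos`, `2cos(π/3) = 1`). -/
theorem fo_iteratedDeriv_factor_four (c : ℂ) :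
    iteratedDeriv 4 (fun t : ℂ ↦ 2 * Complex.cos (t * c + (Real.pi : ℂ) / 3)) 0 = c ^ 4 := by
  have h4 : iteratedDeriv 4 Complex.cos = Complex.cos := by
    simp
  rw [cff_iteratedDeriv_factor, h4, stubEntire_cos_sin_pi_div_three.1]
  ring

/-- **Fourth derivative at zero coupling of a finite twisted product.**  For
`P_S(t) = ∏_{i ∈ S} 2cos(t c_i + π/3)` and the power sums `A_m = Σ_{i∈S} c_i^m`:
`P_S''''(0) = 9A₁⁴ − 72A₁²A₂ + 48A₂² + 96A₁A₃ − 80A₄` (induction on `S`: the Leibniz rule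
`iteratedDeriv_mul` at order `4`, the single-factor values `1, −√3c, −c², √3c³, c⁴`, the lower-order
product values `cff_iteratedDeriv_prod`, and `(√3)² = 3`). -/
theorem fo_iteratedDeriv_four_prod {ι : Type*} (c : ι → ℂ) (S : Finset ι) :
    iteratedDeriv 4 (fun t : ℂ ↦ ∏ i ∈ S, 2 * Complex.cos (t * c i + (Real.pi : ℂ) / 3)) 0 =
      9 * (∑ i ∈ S, c i) ^ 4 - 72 * (∑ i ∈ S, c i) ^ 2 * (∑ i ∈ S, c i ^ 2) +
        48 * (∑ i ∈ S, c i ^ 2) ^ 2 + 96 * (∑ i ∈ S, c i) * (∑ i ∈ S, c i ^ 3) -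
        80 * ∑ i ∈ S, c i ^ 4 := by
  classical
  induction S using Finset.induction_on with
  | empty =>
    simp only [Finset.prod_empty, Finset.sum_empty, iteratedDeriv_const]
    norm_num
  | insert a S ha IH =>
    obtain ⟨IH0, IH1, IH2, IH3⟩ := cff_iteratedDeriv_prod c S
    obtain ⟨F0, F1, F2, F3⟩ := cff_iteratedDeriv_factor_values (c a)
    have F4 := fo_iteratedDeriv_factor_four (c a)
    have hprod : (fun t : ℂ ↦ ∏ i ∈ insert a S, 2 * Complex.cos (t * c i + (Real.pi : ℂ) / 3)) =
        fun t ↦ 2 * Complex.cos (t * c a + (Real.pi : ℂ) / 3) *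
          ∏ i ∈ S, 2 * Complex.cos (t * c i + (Real.pi : ℂ) / 3) :=
      funext fun t ↦ Finset.prod_insert ha
    have hf : ∀ n : ℕ, ContDiffAt ℂ n (fun t : ℂ ↦ 2 * Complex.cos (t * c a + (Real.pi : ℂ) / 3)) 0 :=
      fun n ↦ by fun_prop
    have hg : ∀ n : ℕ,
        ContDiffAt ℂ n (fun t : ℂ ↦ ∏ i ∈ S, 2 * Complex.cos (t * c i + (Real.pi : ℂ) / 3)) 0 :=
      fun n ↦ by fun_prop
    have h3 : ((Real.sqrt 3 : ℝ) : ℂ) * ((Real.sqrt 3 : ℝ) : ℂ) = 3 := by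
      rw [← Complex.ofReal_mul, Real.mul_self_sqrt zero_le_three]
      norm_num
    have hc2 : Nat.choose 4 2 = 6 := by decide
    have hc3 : Nat.choose 4 3 = 4 := by decide
    rw [hprod, Finset.sum_insert ha, Finset.sum_insert ha, Finset.sum_insert ha, Finset.sum_insert ha,
      iteratedDeriv_fun_mul (hf 4) (hg 4)]
    simp only [Finset.sum_range_succ, Finset.sum_range_zero, Nat.reduceSub, Nat.choose_zero_right,
      Nat.choose_one_right, hc2, hc3, Nat.choose_self, IH0, IH1, IH2, IH3, IH, F0, F1, F2, F3, F4]
    push_cast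
    linear_combination (-4 * c a * (-3 * (∑ i ∈ S, c i) ^ 3 + 12 * (∑ i ∈ S, c i) * (∑ i ∈ S, c i ^ 2) -
      8 * ∑ i ∈ S, c i ^ 3) - 4 * c a ^ 3 * ∑ i ∈ S, c i) * h3

/-! ## Sub-goal CF-4: the pathwise fourth derivative -/

/-- **Sub-goal CF-4 (`cf_iteratedDeriv_four_finprod`).**  The fourth `t`-derivative at zero coupling of the
pathwise twisted product `∏ᶠ_{u∈L} 2cos(t θ_u + π/3)` is `9A₁⁴ − 72A₁²A₂ + 48A₂² + 96A₁A₃ − 80A₄`,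
`A_m = Σᶠ_{u∈L} θ_u^m` (the `finprod` is a finite product over the loops meeting the ball,
`stubEntire_finprod_eq_prod`; then `fo_iteratedDeriv_four_prod`). -/
theorem cf_iteratedDeriv_four_finprod : ∀ (f : ℂ → ℝ) (R : ℝ), (∀ z, R < ‖z‖ → f z = 0) → ∫ z, f z = 0 →
    ∀ L : Set (UnbasedLoop ℂ), {u ∈ L | (u.range ∩ Metric.closedBall (0 : ℂ) R).Nonempty}.Finite →
    iteratedDeriv 4 (fun t : ℂ ↦ ∏ᶠ u ∈ L, 2 * Complex.cos (t * ((u.nestingPhase f : ℝ) : ℂ) + (Real.pi : ℂ) / 3)) 0 =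
      ((9 * (∑ᶠ u ∈ L, u.nestingPhase f) ^ 4 - 72 * (∑ᶠ u ∈ L, u.nestingPhase f) ^ 2 * (∑ᶠ u ∈ L, u.nestingPhase f ^ 2) +
        48 * (∑ᶠ u ∈ L, u.nestingPhase f ^ 2) ^ 2 + 96 * (∑ᶠ u ∈ L, u.nestingPhase f) * (∑ᶠ u ∈ L, u.nestingPhase f ^ 3) -
        80 * (∑ᶠ u ∈ L, u.nestingPhase f ^ 4) : ℝ) : ℂ) := by
  intro f R hR h0 L hfin
  have hfun : (fun t : ℂ ↦ ∏ᶠ u ∈ L, 2 * Complex.cos (t * ((u.nestingPhase f : ℝ) : ℂ) + (Real.pi : ℂ) / 3)) =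
      fun t ↦ ∏ u ∈ hfin.toFinset, 2 * Complex.cos (t * ((u.nestingPhase f : ℝ) : ℂ) + (Real.pi : ℂ) / 3) :=
    funext (stubEntire_finprod_eq_prod hR h0 hfin)
  have h4 : (4 : ℕ) ≠ 0 := by decide
  rw [hfun, fo_iteratedDeriv_four_prod (fun u : UnbasedLoop ℂ ↦ ((u.nestingPhase f : ℝ) : ℂ)) hfin.toFinset,
    cff_finsum_eq_sum hR h0 hfin, cff_finsum_pow_eq_sum hR h0 hfin two_ne_zero,
    cff_finsum_pow_eq_sum hR h0 hfin three_ne_zero, cff_finsum_pow_eq_sum hR h0 hfin h4]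
  push_cast
  ring

/-! ## The Gaussian side: `(exp(c t²))''''(0) = 12c²` -/

/-- `(exp(c t²) · 2ct)' = exp(c t²) · (2c + 4c²t²)` as functions (product rule). -/
theorem fo_deriv_cexp_mul_sq_mul_linear (c : ℂ) :
    deriv (fun t : ℂ ↦ Complex.exp (c * t ^ 2) * (2 * c * t)) =
      fun t ↦ Complex.exp (c * t ^ 2) * (2 * c + 4 * c ^ 2 * t ^ 2) := by
  funext t
  have hl : HasDerivAt (fun s : ℂ ↦ 2 * c * s) (2 * c) t := by
    simpa using (hasDerivAt_id t).const_mul (2 * c)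
  rw [((so_hasDerivAt_cexp_mul_sq c t).fun_mul hl).deriv]
  ring

/-- `(exp(c t²) · (2c + 4c²t²))' = exp(c t²) · (12c²t + 8c³t³)` as functions (product rule). -/
theorem fo_deriv_cexp_mul_sq_mul_quadratic (c : ℂ) :
    deriv (fun t : ℂ ↦ Complex.exp (c * t ^ 2) * (2 * c + 4 * c ^ 2 * t ^ 2)) =
      fun t ↦ Complex.exp (c * t ^ 2) * (12 * c ^ 2 * t + 8 * c ^ 3 * t ^ 3) := by
  funext t
  have hl : HasDerivAt (fun s : ℂ ↦ 2 * c + 4 * c ^ 2 * s ^ 2) (4 * c ^ 2 * (2 * t)) t := by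
    refine (((hasDerivAt_pow 2 t).const_mul (4 * c ^ 2)).const_add (2 * c)).congr_deriv ?_
    rw [Nat.cast_ofNat, Nat.add_one_sub_one, pow_one]
  rw [((so_hasDerivAt_cexp_mul_sq c t).fun_mul hl).deriv]
  ring

/-- **`(exp(c t²))''''(0) = 12c²`**: peel three derivatives as functions (`so_hasDerivAt_cexp_mul_sq`,
`fo_deriv_cexp_mul_sq_mul_linear`, `fo_deriv_cexp_mul_sq_mul_quadratic`) and differentiate
`exp(c t²) · (12c²t + 8c³t³)` once more at `t = 0`. -/
theorem fo_iteratedDeriv_four_cexp_mul_sq (c : ℂ) :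
    iteratedDeriv 4 (fun t : ℂ ↦ Complex.exp (c * t ^ 2)) 0 = 12 * c ^ 2 := by
  have h1 : deriv (fun t : ℂ ↦ Complex.exp (c * t ^ 2)) =
      fun t ↦ Complex.exp (c * t ^ 2) * (2 * c * t) :=
    funext fun t ↦ (so_hasDerivAt_cexp_mul_sq c t).deriv
  have hl : HasDerivAt (fun s : ℂ ↦ 12 * c ^ 2 * s + 8 * c ^ 3 * s ^ 3) (12 * c ^ 2) 0 := by
    refine (((hasDerivAt_id (0 : ℂ)).const_mul (12 * c ^ 2)).fun_add
      ((hasDerivAt_pow 3 (0 : ℂ)).const_mul (8 * c ^ 3))).congr_deriv ?_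
    simp
  have h4 : deriv (fun t : ℂ ↦ Complex.exp (c * t ^ 2) * (12 * c ^ 2 * t + 8 * c ^ 3 * t ^ 3)) 0 =
      12 * c ^ 2 := by
    rw [((so_hasDerivAt_cexp_mul_sq c 0).fun_mul hl).deriv]
    simp
  rw [iteratedDeriv_succ', h1, iteratedDeriv_succ', fo_deriv_cexp_mul_sq_mul_linear, iteratedDeriv_succ',
    fo_deriv_cexp_mul_sq_mul_quadratic, iteratedDeriv_one, h4]

/-! ## The percolation side: `Φ_δ''''(0)` is the expectation of a real power-sum statistic -/

/-- For `δ > 0` and admissible `f`: `Φ_δ''''(0) = E_{1/2}[9A₁⁴ − 72A₁²A₂ + 48A₂² + 96A₁A₃ − 80A₄]` (as a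
complex number), by the exchange of derivatives with the expectation (`cf_iteratedDeriv_eq_integral`) and the
pathwise coefficient formula (`cf_iteratedDeriv_four_finprod`; finitely many loops meet `B̄(0, R)` at fixed
mesh, `ncard_loops_siteLoopConfig_meeting_le`). -/
theorem fo_iteratedDeriv_four_eq_ofReal_integral {f : ℂ → ℝ} {R C : ℝ} (hf : Measurable f)
    (hC : ∀ z, |f z| ≤ C) (hR : ∀ z, R < ‖z‖ → f z = 0) (h0 : ∫ z, f z = 0) {δ : ℝ} (hδ : 0 < δ) :
    iteratedDeriv 4 (fun t : ℂ ↦ ∫ ω, (∏ᶠ u ∈ (siteLoopConfig δ ω).loops,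
      2 * Complex.cos (t * ((u.nestingPhase f : ℝ) : ℂ) + (Real.pi : ℂ) / 3)) ∂(triSitePercolation half)) 0 =
    ((∫ ω, (9 * (∑ᶠ u ∈ (siteLoopConfig δ ω).loops, u.nestingPhase f) ^ 4 -
      72 * (∑ᶠ u ∈ (siteLoopConfig δ ω).loops, u.nestingPhase f) ^ 2 *
        (∑ᶠ u ∈ (siteLoopConfig δ ω).loops, u.nestingPhase f ^ 2) +
      48 * (∑ᶠ u ∈ (siteLoopConfig δ ω).loops, u.nestingPhase f ^ 2) ^ 2 +
      96 * (∑ᶠ u ∈ (siteLoopConfig δ ω).loops, u.nestingPhase f) *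
        (∑ᶠ u ∈ (siteLoopConfig δ ω).loops, u.nestingPhase f ^ 3) -
      80 * (∑ᶠ u ∈ (siteLoopConfig δ ω).loops, u.nestingPhase f ^ 4)) ∂(triSitePercolation half) : ℝ) :
      ℂ) := by
  rw [cf_iteratedDeriv_eq_integral f R C hf hC hR h0 δ hδ 4 0, ← integral_complex_ofReal]
  refine integral_congr_ae (Eventually.of_forall fun ω ↦ ?_)
  exact cf_iteratedDeriv_four_finprod f R hR h0 _ (ncard_loops_siteLoopConfig_meeting_le hδ R ω).1

/-! ## Sub-goal FO: the order-4 reduction -/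

/-- **Sub-goal FO (`fo_fourthOrder_of_fourPoint`) · order `4` of the coefficient identification from the
four-point power-sum limit.**  If `E_{1/2}[9A₁⁴ − 72A₁²A₂ + 48A₂² + 96A₁A₃ − 80A₄] → 12 q(f)²` as `δ → 0⁺`
(`A_m = Σ_u θ_u(f)^m`, `q(f) = (3/4π²) ∬ log‖x − y‖ f(x) f(y)`), then any limit `a` of `Φ_δ''''(0)` along
`δ → 0⁺` is `G_f''''(0) = 12 q(f)²` (the Wick value), `G_f(t) = exp(q(f) t²)`: along `𝓝[>] 0` one has
`δ > 0`, where `Φ_δ''''(0) = E_{1/2}[9A₁⁴ − …]` (`fo_iteratedDeriv_four_eq_ofReal_integral`); conclude by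
continuity of `ℝ → ℂ`, uniqueness of limits, and `(exp(c t²))''''(0) = 12c²`
(`fo_iteratedDeriv_four_cexp_mul_sq`). -/
theorem fo_fourthOrder_of_fourPoint : ∀ (f : ℂ → ℝ) (R C : ℝ), Measurable f → (∀ z, |f z| ≤ C) →
    (∀ z, R < ‖z‖ → f z = 0) → ∫ z, f z = 0 →
    Tendsto (fun δ : ℝ ↦ ∫ ω, (9 * (∑ᶠ u ∈ (siteLoopConfig δ ω).loops, u.nestingPhase f) ^ 4 -
      72 * (∑ᶠ u ∈ (siteLoopConfig δ ω).loops, u.nestingPhase f) ^ 2 *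
        (∑ᶠ u ∈ (siteLoopConfig δ ω).loops, u.nestingPhase f ^ 2) +
      48 * (∑ᶠ u ∈ (siteLoopConfig δ ω).loops, u.nestingPhase f ^ 2) ^ 2 +
      96 * (∑ᶠ u ∈ (siteLoopConfig δ ω).loops, u.nestingPhase f) *
        (∑ᶠ u ∈ (siteLoopConfig δ ω).loops, u.nestingPhase f ^ 3) -
      80 * (∑ᶠ u ∈ (siteLoopConfig δ ω).loops, u.nestingPhase f ^ 4)) ∂(triSitePercolation half))
      (𝓝[>] (0 : ℝ)) (𝓝 (12 * (3 / (4 * π ^ 2) * ∫ x, ∫ y, Real.log ‖x - y‖ * f x * f y) ^ 2)) →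
    ∀ a : ℂ, Tendsto (fun δ : ℝ ↦ iteratedDeriv 4 (fun t : ℂ ↦ ∫ ω, (∏ᶠ u ∈ (siteLoopConfig δ ω).loops,
      2 * Complex.cos (t * ((u.nestingPhase f : ℝ) : ℂ) + (Real.pi : ℂ) / 3)) ∂(triSitePercolation half)) 0)
      (𝓝[>] (0 : ℝ)) (𝓝 a) →
    a = iteratedDeriv 4 (fun t : ℂ ↦ Complex.exp
      (((3 / (4 * π ^ 2) * ∫ x, ∫ y, Real.log ‖x - y‖ * f x * f y : ℝ) : ℂ) * t ^ 2)) 0 := by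
  intro f R C hf hC hR h0 hlim a ha
  have hlimC : Tendsto (fun δ : ℝ ↦ iteratedDeriv 4 (fun t : ℂ ↦ ∫ ω, (∏ᶠ u ∈ (siteLoopConfig δ ω).loops,
      2 * Complex.cos (t * ((u.nestingPhase f : ℝ) : ℂ) + (Real.pi : ℂ) / 3)) ∂(triSitePercolation half)) 0)
      (𝓝[>] (0 : ℝ))
      (𝓝 (((12 * (3 / (4 * π ^ 2) * ∫ x, ∫ y, Real.log ‖x - y‖ * f x * f y) ^ 2 : ℝ) : ℂ))) := by
    refine Tendsto.congr' ?_ ((Complex.continuous_ofReal.tendsto _).comp hlim)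
    filter_upwards [self_mem_nhdsWithin] with δ hδ
    exact (fo_iteratedDeriv_four_eq_ofReal_integral hf hC hR h0 (mem_Ioi.1 hδ)).symm
  rw [tendsto_nhds_unique ha hlimC, fo_iteratedDeriv_four_cexp_mul_sq]
  push_cast
  ring

end Summit.CriticalPhenomena.CardyFormulaZ2.Cruxes.MagicFormulaT.LineSketch

end
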